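import Summits.BirchSwinnertonDyer.BirchSwinnertonDyer.Theorems.PrintCf2RubinValueTwoEllipticUnitsLocalMeasure
import HarnessLib

/-!
# The MOMENTS of de Shalit's one-`𝔓` measure for the elliptic units: `∫ κ^{k+1} dμ = (κ(g_𝔠)^{k+1} − N𝔠)⁻¹ · Σ_c κ(r_c)^{k+1}·[S⁰]D^k H_{r_c⁻¹·e(𝔠)}`
# (de Shalit II.4.12 (29)–(31) with II.4.7 (16)–(17), brick B5 ⟶ the socket of B6)

Cell `bsd-print-cf2`, width seat `bsd-line-cf2c-w4` g10; `--supports` stmt-BirchSwinnertonDyer-24721 (helper, Theses-free). THEOREMS ONLY;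
CONDITIONAL on the same de Shalit II.2.4/2.5 named facts as the sibling `…EllipticUnitsLocalMeasure` (hypotheses, never asserted).

Sequel of `PrintCf2RubinValueTwoEllipticUnitsLocalMeasure.lean` (`exists_groupDistribution_twisting_eq_induce_ellipticUnitsLocal`: a bounded
distribution `μ` on `G = Gal(K̄/K(𝔪))` along `K(𝔪v^{n+1})` with `δ_{g_𝔠,N𝔠} μ = i(e(𝔠))` for every twist).  For ANY such `μ` the package's
`integral_character_pow_succ_of_twisting_eq_induce_seriesFamily` (cf2c-w4 g7, p728641) computes the moments; the one extra input is the
SOCKET `hsock` (de Shalit's (11)), discharged for the relative units by cf2c-w4 g9's `seriesFamily_hsock_of_relNormCoherentUnits` (p740405)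
under the continuity / root-of-unity hypotheses on `θ`.  THIS file:

* ★★★ `integral_character_pow_succ_ellipticUnitsLocal` — **for every `𝔠 ∈ I` and `k` with `κ(g_𝔠)^{k+1} ≠ N𝔠`:
  `∫_G κ(g)^{k+1} dμ(g) = (κ(g_𝔠)^{k+1} − N𝔠)⁻¹ · Σ_{c ∈ G/U_0} κ(r_c)^{k+1} · [S⁰] D^k H_{r_c⁻¹ • e(𝔠)}`**, `κ = κ_v⁻¹` read in `ℤ₂`,
  `H_β = Θ(j((δ_E g_β)~) ∘ ϑ)` the `Θ`-read log-free series of the relative Coleman series of `β ∈ 𝒰_𝔓` — the left side of de Shalit's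
  interpolation formula II.4.7 (17)/(36) for the measure of the sibling; the right side (Eisenstein numbers = `L`-values, II.4.9–4.10) is brick B6.

HONEST FRAMING: an instantiation of accepted kernel theorems; nothing here closes a crux; no summit statement is proved; BSD is not proved by any of this.

## References
* [deShalit1987] E. de Shalit, *Iwasawa theory of elliptic curves with complex multiplication* (1987), II.4.7 (16)–(17) (p. 60),
  II.4.12 (29)–(31) (p. 67–69), I.3.5 (11) (p. 18).
-/

-- the summit namespace `Summit.BirchSwinnertonDyer.BirchSwinnertonDyer` repeats the problem name by design (D-0017)
set_option linter.dupNamespace false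
set_option autoImplicit false

noncomputable section

open scoped Classical nonZeroDivisors
open scoped NumberField
open Field IsDedekindDomain IsDedekindDomain.HeightOneSpectrum ValuativeRel IsLocalRing MvPowerSeries
open Literature.NumberTheory.NumberFields
open Literature.NumberTheory.GaloisRepresentations Literature.NumberTheory.GaloisRepresentations.IsNonarchimedeanLocalField
  Literature.NumberTheory.GaloisRepresentations.LubinTate Literature.NumberTheory.GaloisRepresentations.ArtinLocalGlobal
  Literature.NumberTheory.PAdicHodge
open Literature.NumberTheory.EllipticCurves Literature.NumberTheory.EllipticCurves.GroupDistribution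
open Literature.NumberTheory.ComplexMultiplication.EllipticUnits
open Literature.NumberTheory.LFunctions.AbelianDensity (artinSymbol)

namespace Summit.BirchSwinnertonDyer.BirchSwinnertonDyer.Theorems.PrintCf2.EllipticUnitsLocal

variable {K : Type} [Field K] [NumberField K] {𝔪 : Ideal (𝓞 K)} {v : HeightOneSpectrum (𝓞 K)}

section Assembly

attribute [local instance] ltNormUniformSpace ltNormIsUniformAddGroup rk1 nF nE fintypeResidueField
attribute [local instance] RelNormCoherentUnits.instCommMonoid

variable [NumberField.IsTotallyComplex K]
  -- the prints and the global frame
  (h24ii : DeShalit1987.prop24_ii_galoisAction) (h24iii : DeShalit1987.prop24_iii_unit) (h25 : DeShalit1987.prop25_i_normRelation)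
  (hK : IsImaginaryQuadratic K) (ι : K →+* ℂ)
  (h𝔪0 : 𝔪 ≠ ⊥) (h𝔪1 : 𝔪 ≠ ⊤) (hv : ¬ 𝔪 ≤ v.asIdeal) (hw : ∀ u : (𝓞 K)ˣ, (u : 𝓞 K) - 1 ∈ 𝔪 → u = 1)
  -- the absolute Lubin–Tate model `π = u·2` at `v` and its unramified base `E`
  (hq : residueFieldCard (v.adicCompletion K) = 2)
  (h2 : (valuation (v.adicCompletion K)).IsUniformizer ((((2 : ℕ) : 𝒪[v.adicCompletion K]) : v.adicCompletion K)))
  (u : 𝒪[v.adicCompletion K]ˣ)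
  {α : 𝓞 K} (hα0 : α ≠ 0) (hα𝔪 : α - 1 ∈ 𝔪) (hαw : ∀ w : HeightOneSpectrum (𝓞 K), w ≠ v → α ∉ w.asIdeal)
  {f : ℕ} (hαπ : ((α : K) : v.adicCompletion K) =
    ((((u : 𝒪[v.adicCompletion K]) * ((2 : ℕ) : 𝒪[v.adicCompletion K]) : 𝒪[v.adicCompletion K]) : v.adicCompletion K)) ^ f)
  (E : IntermediateField (v.adicCompletion K) (AlgebraicClosure (v.adicCompletion K)))
  [FiniteDimensional (v.adicCompletion K) E] [IsGalois (v.adicCompletion K) E] (hE : E ≤ maxUnramified (v.adicCompletion K))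
  (hdegE : ∀ w : WeilGroup (v.adicCompletion K),
    WeilGroup.toAbsGalois (v.adicCompletion K) w ∈ E.fixingSubgroup → (f : ℤ) ∣ WeilGroup.deg w)
  -- the local analytic data: arithmetic Frobenius, the unit `ε`, the reading `θ : ℂ_{K_v} → ℂ₂`, `j : 𝒪_E → 𝐃`, `e₂ : 𝒪_v ≃ ℤ₂`
  {σ₀ : absoluteGaloisGroup (v.adicCompletion K)} (hσ₀ : IsAbsArithFrob σ₀)
  {ε : (maxUnramifiedCompletion (v.adicCompletion K))ˣ}
  (hε : maxUnramifiedCompletion.galAut (v.adicCompletion K) σ₀ (ε : maxUnramifiedCompletion (v.adicCompletion K)) =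
    algebraMap 𝒪[v.adicCompletion K] (maxUnramifiedCompletion (v.adicCompletion K)) (u : 𝒪[v.adicCompletion K]) *
      (ε : maxUnramifiedCompletion (v.adicCompletion K)))
  (θ : CompletedAlgClosure (v.adicCompletion K) →+* ℂ_[2]) (hθc : Continuous θ)
  (hθ1 : ∀ z : CBall (v.adicCompletion K), ‖θ (z : CompletedAlgClosure (v.adicCompletion K))‖ ≤ 1)
  (hθζ : ∀ ζ' : ℂ_[2], (∃ n : ℕ, ζ' ^ 2 ^ n = 1) →
    ∃ ζ : CompletedAlgClosure (v.adicCompletion K), (∃ n : ℕ, ζ ^ 2 ^ n = 1) ∧ θ ζ = ζ')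
  (j : unitBall E →+* UnrCoeff (v.adicCompletion K))
  (hj : j.comp (algebraMap (LTCoeff (v.adicCompletion K)) (unitBall E)) =
    (intToUnrCoeff (v.adicCompletion K)).comp (LTCoeff.of (v.adicCompletion K)).symm.toRingHom)
  (hjC : (algebraMap (UnrCoeff (v.adicCompletion K)) (CBall (v.adicCompletion K))).comp j = unitBallToCBall E)
  (e₂ : v.adicCompletionIntegers K ≃+* ℤ_[2])
  (hΘe : ∀ a : 𝒪[v.adicCompletion K], (θ.comp ((CBall (v.adicCompletion K)).subtype.comp
      (algebraMap (UnrCoeff (v.adicCompletion K)) (CBall (v.adicCompletion K))))) (intToUnrCoeff (v.adicCompletion K) a) =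
    padicIntCast ℂ_[2] (((e₂ : v.adicCompletionIntegers K →+* ℤ_[2]).comp
      (integerEquivAdicCompletionIntegers v).toRingHom) a))
  -- the cell maps of the tower `K(𝔪v^{n+1})` for `κ := κ_v⁻¹` read in `ℤ₂`
  (ψ : (n : ℕ) → ↥(absRestrictNormalHom (rayClassField K 𝔪)).ker ⧸ (rayAdicTower (𝔪 := 𝔪) h𝔪0 v).U n → ZMod (2 ^ (n + 1)))
  (hψ : ∀ (n : ℕ) (g : ↥(absRestrictNormalHom (rayClassField K 𝔪)).ker), g ∈ (rayAdicTower (𝔪 := 𝔪) h𝔪0 v).U 0 →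
    ψ n ((rayAdicTower (𝔪 := 𝔪) h𝔪0 v).proj n g) =
      PadicInt.toZModPow (n + 1) ((((Units.map (e₂ : v.adicCompletionIntegers K →+* ℤ_[2]).toMonoidHom).comp
        (rayAdicCharacter h𝔪0 hv hw))⁻¹ g : ℤ_[2]ˣ) : ℤ_[2]))
  -- the twists: ideals `𝔠` prime to `𝔪v`, Galois lifts `g_𝔠 ∈ Gal(K̄/K(𝔪))` of their Artin symbols, elliptic-unit families under `Θ(1; 𝔪v^{m+1}, 𝔠)`
  {I : Type*} (idl : I → Ideal (𝓞 K)) (hidl0 : ∀ i, idl i ≠ ⊥) (hidlc : ∀ i, IsCoprime (idl i) (𝔪 * v.asIdeal))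
  (g : I → ↥(absRestrictNormalHom (rayClassField K 𝔪)).ker)
  (hg : ∀ (i : I) (m : ℕ), absRestrictNormalHom (rayClassField K (𝔪 * v.asIdeal ^ (m + 1))) (g i : absoluteGaloisGroup K) =
    artinSymbol (galFrob K (rayClassField K (𝔪 * v.asIdeal ^ (m + 1)))) (idl i))
  (x : ∀ (i : I) (m : ℕ), rayClassField K (𝔪 * v.asIdeal ^ (m + 1)))
  (hx : ∀ (i : I) (m : ℕ), IsThetaValueOne ι (𝔪 * v.asIdeal ^ (m + 1)) (idl i)
    (algClosureEmb ι ((x i m : rayClassField K (𝔪 * v.asIdeal ^ (m + 1))) : AlgebraicClosure K)))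

set_option maxHeartbeats 800000 in
include hq hθc hθζ hjC in
/-- ★★★ **THE MOMENTS of the one-`𝔓` measure of the elliptic units** (de Shalit II.4.12 (29)–(31) with II.4.7 (16)–(17)): for ANY bounded
distribution `μ` on `Gal(K̄/K(𝔪))` along `K(𝔪v^{n+1})` with `δ_{g_𝔠, N𝔠} μ = i(e(𝔠))` levelwise for every twist `𝔠 ∈ I` (the sibling's
`exists_groupDistribution_twisting_eq_induce_ellipticUnitsLocal`), every `𝔠 ∈ I` and every `k` with `κ(g_𝔠)^{k+1} ≠ N𝔠` in `ℂ₂`: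
**`∫_G κ(g)^{k+1} dμ(g) = (κ(g_𝔠)^{k+1} − N𝔠)⁻¹ · Σ_{c ∈ G/U_0} κ(r_c)^{k+1} · [S⁰] D^k H_{r_c⁻¹ • e(𝔠)}`** (`κ = κ_v⁻¹` in `ℤ₂`,
`r_c` the tower's representatives, `H_β = Θ(j((δ_E g_β)~) ∘ ϑ)`; the socket (11) from the trace-zero property of the relative log-free series,
`seriesFamily_hsock_of_relNormCoherentUnits`). [cite: deShalit1987, II.4.12 (29)–(31) (p. 67–69), II.4.7 (16)–(17) (p. 60), I.3.5 (11) (p. 18)] -/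
theorem integral_character_pow_succ_ellipticUnitsLocal
    [hN : ∀ n, ((rayAdicTower (𝔪 := 𝔪) h𝔪0 v).U n).Normal]
    (μ : GroupDistribution (rayAdicTower (𝔪 := 𝔪) h𝔪0 v) ℂ_[2])
    (hμ : letI := rayAction h𝔪0 hv hw (isUniformizer_unit_mul h2 u) E hE
      ∀ (c : I) (n : ℕ) (b : ↥(absRestrictNormalHom (rayClassField K 𝔪)).ker ⧸ (rayAdicTower (𝔪 := 𝔪) h𝔪0 v).U n),
        (twisting (g c) (Ideal.absNorm (idl c) : ℂ_[2]) μ).μ n b =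
        (GroupDistribution.induce
          (fun β : RelNormCoherentUnits (isUniformizer_unit_mul h2 u) E ↦
            (GroupDistribution.comap (restrictUnits ((invAmice₁ 2 ((PowerSeries.subst (compSeriesC h2 hσ₀ u hε)
              ((relTildeSeries (isUniformizer_unit_mul h2 u) E hq hE hσ₀
                (LTCoeff.of (v.adicCompletion K) (u : 𝒪[v.adicCompletion K])) β).map j)).map
              (θ.comp ((CBall (v.adicCompletion K)).subtype.comp
                (algebraMap (UnrCoeff (v.adicCompletion K)) (CBall (v.adicCompletion K))))))
              (norm_coeff_relSeries_le_one hq h2 u E hE hσ₀ hε θ hθ1 j hjC β)).density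
              (ProfiniteTower.padicInt_isUniform 2) (unitInv ℂ_[2]) uniformContinuous_unitInv norm_unitInv_le))
              ψ ((rayAdicTower (𝔪 := 𝔪) h𝔪0 v).cellMap_trans (((Units.map (e₂ : v.adicCompletionIntegers K →+* ℤ_[2]).toMonoidHom).comp (rayAdicCharacter h𝔪0 hv hw))⁻¹) ψ hψ)
              ((rayAdicTower (𝔪 := 𝔪) h𝔪0 v).cellMap_injective (((Units.map (e₂ : v.adicCompletionIntegers K →+* ℤ_[2]).toMonoidHom).comp (rayAdicCharacter h𝔪0 hv hw))⁻¹)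
                (mem_rayAdicTower_iff_inv h𝔪0 h𝔪0 hv hw e₂ le_rfl hv) ψ hψ)
              ((rayAdicTower (𝔪 := 𝔪) h𝔪0 v).cellMap_fiberSurj (((Units.map (e₂ : v.adicCompletionIntegers K →+* ℤ_[2]).toMonoidHom).comp (rayAdicCharacter h𝔪0 hv hw))⁻¹)
                (mem_rayAdicTower_iff_inv h𝔪0 h𝔪0 hv hw e₂ le_rfl hv)
                (exists_toZModPow_padicRayAdicCharacter_inv_eq h𝔪0 h𝔪0 hv hw e₂ le_rfl hv) ψ hψ)))
          zero_le_one (fun _ ↦ le_rfl)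
          (ellipticUnitsLocal h24iii h25 hK ι h𝔪0 h𝔪1 hv hw (isUniformizer_unit_mul h2 u) hα0 hα𝔪 hαw hαπ E hE hdegE
            (hidl0 c) (hidlc c) (x c) (hx c))).μ n b)
    (c : I) (k : ℕ)
    (hne : padicIntCast ℂ_[2] (((((Units.map (e₂ : v.adicCompletionIntegers K →+* ℤ_[2]).toMonoidHom).comp (rayAdicCharacter h𝔪0 hv hw))⁻¹) (g c) : ℤ_[2]) ^ (k + 1)) ≠ (Ideal.absNorm (idl c) : ℂ_[2])) :
    letI := rayAction h𝔪0 hv hw (isUniformizer_unit_mul h2 u) E hE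
    μ.integral (fun σ ↦ padicIntCast ℂ_[2] (((((Units.map (e₂ : v.adicCompletionIntegers K →+* ℤ_[2]).toMonoidHom).comp (rayAdicCharacter h𝔪0 hv hw))⁻¹) σ : ℤ_[2]) ^ (k + 1))) =
      (padicIntCast ℂ_[2] (((((Units.map (e₂ : v.adicCompletionIntegers K →+* ℤ_[2]).toMonoidHom).comp (rayAdicCharacter h𝔪0 hv hw))⁻¹) (g c) : ℤ_[2]) ^ (k + 1)) - (Ideal.absNorm (idl c) : ℂ_[2]))⁻¹ *
        ∑ c' ∈ (rayAdicTower (𝔪 := 𝔪) h𝔪0 v).cells 0,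
          padicIntCast ℂ_[2] (((((Units.map (e₂ : v.adicCompletionIntegers K →+* ℤ_[2]).toMonoidHom).comp (rayAdicCharacter h𝔪0 hv hw))⁻¹) ((rayAdicTower (𝔪 := 𝔪) h𝔪0 v).repr 0 c') : ℤ_[2]) ^ (k + 1)) *
          PowerSeries.constantCoeff (mahlerD^[k] ((PowerSeries.subst (compSeriesC h2 hσ₀ u hε)
            ((relTildeSeries (isUniformizer_unit_mul h2 u) E hq hE hσ₀ (LTCoeff.of (v.adicCompletion K) (u : 𝒪[v.adicCompletion K]))
              (((rayAdicTower (𝔪 := 𝔪) h𝔪0 v).repr 0 c')⁻¹ • (ellipticUnitsLocal h24iii h25 hK ι h𝔪0 h𝔪1 hv hw (isUniformizer_unit_mul h2 u) hα0 hα𝔪 hαw hαπ E hE hdegE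
            (hidl0 c) (hidlc c) (x c) (hx c)))).map j)).map
            (θ.comp ((CBall (v.adicCompletion K)).subtype.comp
              (algebraMap (UnrCoeff (v.adicCompletion K)) (CBall (v.adicCompletion K))))))) := by
  letI := rayAction h𝔪0 hv hw (isUniformizer_unit_mul h2 u) E hE
  exact integral_character_pow_succ_of_twisting_eq_induce_seriesFamily (h2 := h2) (hσ₀ := hσ₀) (u := u) (hε := hε)
    (Θ := θ.comp ((CBall (v.adicCompletion K)).subtype.comp
      (algebraMap (UnrCoeff (v.adicCompletion K)) (CBall (v.adicCompletion K)))))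
    (κ := (((Units.map (e₂ : v.adicCompletionIntegers K →+* ℤ_[2]).toMonoidHom).comp (rayAdicCharacter h𝔪0 hv hw))⁻¹))
    (hU := mem_rayAdicTower_iff_inv h𝔪0 h𝔪0 hv hw e₂ le_rfl hv)
    (hκ := exists_toZModPow_padicRayAdicCharacter_inv_eq h𝔪0 h𝔪0 hv hw e₂ le_rfl hv) (ψ := ψ) (hψ := hψ)
    (φ := fun β : RelNormCoherentUnits (isUniformizer_unit_mul h2 u) E ↦
      (relTildeSeries (isUniformizer_unit_mul h2 u) E hq hE hσ₀ (LTCoeff.of (v.adicCompletion K) (u : 𝒪[v.adicCompletion K])) β).map j)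
    (hC := norm_coeff_relSeries_le_one hq h2 u E hE hσ₀ hε θ hθ1 j hjC)
    (hsock := fun β k ↦ seriesFamily_hsock_of_relNormCoherentUnits (hq := hq) (h2 := h2) (u := u) (E := E) (hE := hE)
      (hσ₀ := hσ₀) (j := j) (hε := hε) (θ := θ) (hθc := hθc) (hθ1 := hθ1) (hθζ := hθζ) (hjC := hjC) β
      (norm_coeff_relSeries_le_one hq h2 u E hE hσ₀ hε θ hθ1 j hjC β) k)
    (hC0 := zero_le_one) (hCb := fun _ ↦ le_rfl)
    (β := fun c ↦ (ellipticUnitsLocal h24iii h25 hK ι h𝔪0 h𝔪1 hv hw (isUniformizer_unit_mul h2 u) hα0 hα𝔪 hαw hαπ E hE hdegE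
            (hidl0 c) (hidlc c) (x c) (hx c)))
    (σ := g) (Nm := fun c ↦ Ideal.absNorm (idl c)) μ hμ c k hne

end Assembly

end Summit.BirchSwinnertonDyer.BirchSwinnertonDyer.Theorems.PrintCf2.EllipticUnitsLocal

end
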